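/-
Copyright (c) 2026 the pub-hodgecm-mathlib formalisation cell (harness21).  Prover seat hodgecm-mathlib-LH4-p06 (g9), req620 Track A «(D-RAM) FOUR-FRAME» squad
F0∕P3c∕LH4; the (β₂) road (R-36) «PURE-CELL LEDGER», β₂ WORD #27 (a)∕#28 (a)∕#40 of the sub-dealer LH4-p04 (g10): piece ‹D0›, file D0-4 = the ONE arithmetic input of the direct
two-literal road «the conductor-zero affine sign sums to zero over the non-X digits»; helper lane on h413 = stmt-HodgeConjecture-24833 (count-neutral).  2026-09-05.
-/
import Literature.NumberTheory.LocalFields.WildQuadraticDatumNormSignConductor   -- ★ (LH4-p06 (g3) lineage): `sum_normSign_repr_eq_zero` (the non-norm involution on a system of representatives); brings ★ `normSign`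
import Summits.HodgeConjecture.HodgeConjecture.Theorems.F0P3cDyRamFourFramePieces    -- ★ DEFS (opens only; keeps the file in the crux's import cone)
import HarnessLib

/-!
# Crux `H413`, line LH4 «(D-RAM) FOUR-FRAME» — STAGE-1b, row (2), the (β₂) road (R-36), lane B, piece ‹D0› (β₂ WORD #24∕#27∕#28∕#40), file D0-4: «OVER A DIGIT SYSTEM OF THE
# FIXED INTEGERS, OFF THE X-DIGIT, THE CONDUCTOR-ZERO AFFINE SIGN `ω(α₁ + γ₁V)` SUMS TO ZERO»

Cell `hodgecm-mathlib` (D-0151), FLOOR 0, crux item H413 = `stmt-HodgeConjecture-24833`, route of record `HCCMUnconditional`; squad F0∕P3c∕LH4; lane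
`--supports stmt-HodgeConjecture-24833 --as helper` (count-neutral; pays NO tier-0 row).  THEOREMS ONLY (no `def`, no instance, no notation, no `sorry`, default heartbeats);
★-only imports; states NO law; (β₂) stays a HYPOTHESIS.  Letters: a complete sheet datum `IsRamifiedQuadraticDatum σ ϖ d t` on `K` with finite residue field and `|2| < 1`; the
affine letters of ★ D0-1 `exists_affineLabel_of_coords_of_gap_zero` (`σ`-fixed `α₁, γ₁`, `|γ₁| = 1`); a digit system `Rd` of the `σ`-fixed integers modulo `|ϖ|^{2d}` (★ K7
`cellDiff_diag_eq_zero_of_reads`' letters `hRd1 hRd2 hRd3` VERBATIM); `ω = normSign σ`.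

WHY (β₂ WORD #40 (2) «= direct two-literal payment of ‹D0›»; this seat 02:08Z).  On the direct road ‹D0.v1› is ★ p864238 `sum_window_eq_sum_window_of_digit_partition` (LH7-p06 (g3))
at the ONE-cell window with digit set `B := Rd ∖ (X-class)`, `X-class = {V ∣ |α₁ + γ₁V| < 1}` (★ D0-1∕D0-2∕D0-3: those digits carry neither shell nor label), literal classes
`B ∩ LIT_H`, `B ∩ ¬LIT_H`, label character `ω(V) := normSign σ (α₁ + γ₁V)`, and the ONE arithmetic input `Σ_{V ∈ B} ω(α₁ + γ₁V) = 0`.  This file is that input: `V ↦ α₁ + γ₁V`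
(`|γ₁| = 1`, both fixed) carries `B` onto a complete irredundant system of representatives of the fixed UNITS modulo `𝔭^{2d}`, on which ★ `sum_normSign_repr_eq_zero` (the
non-norm involution; `2d ≥ 2d − 1`) gives zero.
* HEAD `sum_normSign_affine_unitDigits_eq_zero` — `Σ_{V ∈ Rd, |α₁ + γ₁V| = 1} normSign σ (α₁ + γ₁V) = 0`.
WHAT IS NOT CLAIMED: the per-literal cell identities at δ = 0 (★ K6-0 instances, K6 desk), the window instantiation, ‹D0› itself.
HONEST LABEL.  Count-neutral arithmetic; nothing printed is asserted; ‹D0› OPEN; `HC_CM` is proved only modulo the 7 printed citations (2 remaining named inputs: hLiu418 =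
`stmt-HodgeConjecture-24832`, h413 = `stmt-HodgeConjecture-24833`) until rung 0 closes.
## References
* [Serre1979] J.-P. Serre, *Local Fields*, GTM 67 (1979): Ch. V §3 Cor. 3 pp. 85–87; Ch. XV §2 (norm residue symbol, conductor).
* [NeukirchANT1999] J. Neukirch, *Algebraic Number Theory* (1999): Ch. V (1.3) (norm residue symbol on units).
* [LabesseLanglands1979] J.-P. Labesse, R. P. Langlands, *L-indistinguishability for SL(2)*, Canad. J. Math. 31 (1979): §2 (2.2) p. 9 (κ-signed counts).
-/

set_option autoImplicit false

noncomputable section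

namespace Summit.HodgeConjecture.HodgeConjecture.Cruxes.H413.F0P3cDyRamDiagonalCellUnitDigitSumDeltaZero

open scoped Valued WithZero
open WithZero
open Literature.NumberTheory.Automorphic.UnitaryThreeFourFrame (IsRamifiedQuadraticDatum normSign)
open Literature.NumberTheory.LocalFields.WildQuadraticDatum (sum_normSign_repr_eq_zero)

variable {K : Type} [Field K] [Valued K ℤᵐ⁰] {σ : K →+* K} {ϖ : K} {d t : ℕ}

/-- **HEAD — «OFF THE X-DIGIT THE CONDUCTOR-ZERO AFFINE SIGN SUMS TO ZERO».**  Complete sheet datum with finite residue field, `|2| < 1`; `σ`-fixed `α₁` (`|α₁| ≤ 1`) and `γ₁`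
(`|γ₁| = 1`); `Rd` a complete irredundant system of representatives of the `σ`-fixed integers modulo `|ϖ|^{2d}` (★ K7's `hRd1 hRd2 hRd3`).  THEN
`Σ_{V ∈ Rd, |α₁ + γ₁V| = 1} normSign σ (α₁ + γ₁V) = 0` — the image `{α₁ + γ₁V}` of the non-X digits is a complete irredundant system of representatives of the fixed units
modulo `𝔭^{2d}`, and ★ `sum_normSign_repr_eq_zero` applies (`2d − 1 ≤ 2d`; the fixed units are stable under unit multiplication). [cite: Serre1979, Ch. V §3 Cor. 3; Ch. XV §2]
[cite: NeukirchANT1999, Ch. V (1.3)] [cite: LabesseLanglands1979, §2 (2.2) p. 9] -/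
theorem sum_normSign_affine_unitDigits_eq_zero [CompleteSpace K] [Finite 𝓀[K]] (hD : IsRamifiedQuadraticDatum σ ϖ d t) (h2v : Valued.v (2 : K) < 1)
    {α₁ γ₁ : K} (hσα : σ α₁ = α₁) (hα1 : Valued.v α₁ ≤ 1) (hσγ : σ γ₁ = γ₁) (hγ1 : Valued.v γ₁ = 1)
    (Rd : Finset K) (hRd1 : ∀ V ∈ Rd, σ V = V ∧ Valued.v V ≤ 1)
    (hRd2 : ∀ V : K, σ V = V → Valued.v V ≤ 1 → ∃ V₀ ∈ Rd, Valued.v (V - V₀) ≤ Valued.v ϖ ^ (2 * d))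
    (hRd3 : ∀ V ∈ Rd, ∀ V' ∈ Rd, Valued.v (V - V') ≤ Valued.v ϖ ^ (2 * d) → V = V') :
    ∑ V ∈ Rd.filter (fun V => Valued.v (α₁ + γ₁ * V) = 1), normSign σ (α₁ + γ₁ * V) = 0 := by
  classical
  obtain ⟨-, -, hϖ, -, -, hd1, -⟩ := id hD
  have hϖlt : Valued.v ϖ < 1 := by rw [hϖ, ← exp_zero, exp_lt_exp]; norm_num
  have hγ0 : γ₁ ≠ 0 := fun h0 => by rw [h0, map_zero] at hγ1; exact zero_ne_one hγ1
  have hsmall : Valued.v ϖ ^ (2 * d) < 1 := pow_lt_one₀ zero_le hϖlt (by omega)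
  -- the affine map is injective on the digits
  set φ : K → K := fun V => α₁ + γ₁ * V with hφ
  have hinj : ∀ V ∈ Rd.filter (fun V => Valued.v (α₁ + γ₁ * V) = 1), ∀ V' ∈ Rd.filter (fun V => Valued.v (α₁ + γ₁ * V) = 1), φ V = φ V' → V = V' := by
    intro V _ V' _ h
    have h' : γ₁ * V = γ₁ * V' := add_left_cancel h
    exact mul_left_cancel₀ hγ0 h'
  rw [← Finset.sum_image hinj]
  -- ★ the non-norm involution on a complete irredundant system of representatives of the fixed units modulo `𝔭^{2d}`
  refine sum_normSign_repr_eq_zero hD h2v (ρ := 2 * d) (by omega) (A := {f : K | σ f = f ∧ Valued.v f = 1}) (fun f hf => hf)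
    (fun f hf a hσa ha1 _ => ⟨by rw [map_mul, hσa, hf.1], by rw [Valuation.map_mul, ha1, hf.2, one_mul]⟩) _ ?_ ?_ ?_
  · -- `S ⊆ A`
    intro g hg
    obtain ⟨V, hV, rfl⟩ := Finset.mem_image.1 hg
    obtain ⟨hVR, hV1⟩ := Finset.mem_filter.1 hV
    exact ⟨by rw [hφ]; dsimp only; rw [map_add, map_mul, hσα, hσγ, (hRd1 V hVR).1], hV1⟩
  · -- completeness: every fixed unit `f` is `α₁ + γ₁V` up to `𝔭^{2d}` with `V = (f − α₁)∕γ₁` a fixed integer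
    intro f hf
    obtain ⟨hσf, hf1⟩ := hf
    have hσV : σ ((f - α₁) / γ₁) = (f - α₁) / γ₁ := by rw [map_div₀, map_sub, hσf, hσα, hσγ]
    have hV1 : Valued.v ((f - α₁) / γ₁) ≤ 1 := by
      rw [map_div₀, hγ1, div_one]
      exact (Valuation.map_sub _ _ _).trans (max_le hf1.le hα1)
    obtain ⟨V₀, hV₀, hclose⟩ := hRd2 _ hσV hV1
    have hdist : Valued.v (f - φ V₀) ≤ Valued.v ϖ ^ (2 * d) := by
      have e : f - φ V₀ = γ₁ * ((f - α₁) / γ₁ - V₀) := by rw [hφ]; dsimp only; field_simp; ring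
      rw [e, Valuation.map_mul, hγ1, one_mul]; exact hclose
    have hunit : Valued.v (φ V₀) = 1 := by
      have hlt : Valued.v (f - φ V₀) < Valued.v f := by rw [hf1]; exact lt_of_le_of_lt hdist hsmall
      have e : φ V₀ = f - (f - φ V₀) := by ring
      rw [e, Valuation.map_sub_eq_of_lt_left _ hlt, hf1]
    exact ⟨φ V₀, Finset.mem_image.2 ⟨V₀, Finset.mem_filter.2 ⟨hV₀, hunit⟩, rfl⟩, hdist⟩
  · -- irredundancy: `|φ V − φ V′| = |V − V′|`
    intro g hg g' hg' hgg'
    obtain ⟨V, hV, rfl⟩ := Finset.mem_image.1 hg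
    obtain ⟨V', hV', rfl⟩ := Finset.mem_image.1 hg'
    have e : φ V - φ V' = γ₁ * (V - V') := by rw [hφ]; dsimp only; ring
    rw [e, Valuation.map_mul, hγ1, one_mul] at hgg'
    rw [hRd3 V (Finset.mem_filter.1 hV).1 V' (Finset.mem_filter.1 hV').1 hgg']

end Summit.HodgeConjecture.HodgeConjecture.Cruxes.H413.F0P3cDyRamDiagonalCellUnitDigitSumDeltaZero

end
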